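import Mathlib.Data.Rat.Floor
import Summits.NavierStokesRegularity.FluidComputer.ChainFieldI
import HarnessLib

/-!
# The reference-defect bound of the ramp-enclosure kernel in exact rational arithmetic
# (`kgen19.defect_bound`; `pub-fluidc-bp3/R1-DESIGN.md` §9.2 `hDB`, layer B of `structure Row`) — executable part

HONEST FRAMING (cell `pub-fluidc`, blueprint seat bp3, gen 20): low prior, high value-of-information
experiment on Tao's machine paradigm; NOT a claim that NS blows up. Exact rational bookkeeping only.

On a row the reference is the polynomial `x̂_i(u) = Σ_{m ≤ DEG} CQ_{i,m} u^m` (`u ∈ [0, H]`, exact rational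
coefficients). Its defect `d_i(u) = x̂_i'(u) − F_i(x̂(u))` is a polynomial of degree `n = 2·DEG` whose exact
coefficients are `defectQ i m = (m+1) CQ_{i,m+1} − Σ_τ c_τ · (CQ_{j_τ} * CQ_{k_τ})_m` over the monomial table
`ChainField.terms` with EXACT rational couplings (`Term.coefQ`; the kernel's `TERMS`, not the interval table);
the kernel bounds `sup_{[0,H]} |d_i|` by the Bernstein enclosure (`BernsteinEnclosure.abs_poly_le_on_Icc`):
`DB_i = ⌈max_j |b_j| · 2^P⌉`, `b_j = Σ_{m ≤ j} C(j,m)/C(n,m) · defectQ i m · H^m`. This file is the computable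
twin (`polyCoeff`, `defectQ`, `bernQ`, `defectBound`), reproducing the kernel's integers `DB` bit-exactly
(test: `g20/Row0.selftest.lean`); the soundness theorem (`|x̂_i'(u) − F_i(x̂(u))| ≤ DB_i / 2^P` on `[0, H]`, from
`Fsum_eq`, the product rule for coefficient lists and `abs_poly_le_on_Icc`) is the table layer's (`Row.sound`).

[cite: Tao2016AveragedNS, §5.5 Thm 5.3 (5.5)]
-/

namespace Summit.NavierStokesRegularity.FluidComputer

namespace ChainField

/-- Exact rational coefficient of a term over rational coupling tables `qU` (upstream `ε σ ν μ r κ`) and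
`qD` (downstream, `= Λ ·` upstream as exact rationals). [folklore] -/
def Term.coefQ (qU qD : Fin 6 → ℚ) (τ : Term) : ℚ :=
  (if τ.sgn then -1 else 1) * (if τ.dn then qD τ.c else qU τ.c)

/-- Coefficient `m` of the product of two coefficient lists (`poly_mul_q`). [folklore] -/
def polyCoeff (p q : List ℚ) (m : ℕ) : ℚ :=
  ((List.range (m + 1)).map fun i => p.getD i 0 * q.getD (m - i) 0).sum

/-- Coefficient `m` of the defect polynomial `x̂_i' − F_i(x̂)` of the reference with coefficient lists `CQ`.
[folklore] -/
def defectQ (qU qD : Fin 6 → ℚ) (CQ : Fin 9 → List ℚ) (i : Fin 9) (m : ℕ) : ℚ :=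
  ((m : ℚ) + 1) * (CQ i).getD (m + 1) 0
    - ((terms i).map fun τ => τ.coefQ qU qD * polyCoeff (CQ τ.j) (CQ τ.k) m).sum

/-- Bernstein coefficient `j` (degree `n`) of a coefficient sequence: `Σ_{m ≤ j} C(j,m)/C(n,m) · dt m`
(`BernsteinEnclosure.coeff` over `ℚ`). [folklore] -/
def bernQ (n : ℕ) (dt : ℕ → ℚ) (j : ℕ) : ℚ :=
  ((List.range (j + 1)).map fun m => ((j.choose m : ℚ) / (n.choose m : ℚ)) * dt m).sum

/-- The largest Bernstein coefficient in absolute value (`max_j |b_j|`, degree `n`, on `[0, H]`). [folklore] -/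
def bernMax (n : ℕ) (H : ℚ) (d : ℕ → ℚ) : ℚ :=
  ((List.range (n + 1)).map fun j => |bernQ n (fun m => d m * H ^ m) j|).foldl max 0

/-- **The kernel's defect bound** `DB_i = ⌈max_j |b_j| · 2^P⌉` (`defect_bound`), degree `n = 2·DEG`. [folklore] -/
def defectBound (P DEG : ℕ) (qU qD : Fin 6 → ℚ) (H : ℚ) (CQ : Fin 9 → List ℚ) (i : Fin 9) : ℤ :=
  ⌈bernMax (2 * DEG) H (defectQ qU qD CQ i) * 2 ^ P⌉

end ChainField

end Summit.NavierStokesRegularity.FluidComputer
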